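/-
COR-CM (cell pub-hodgecm2, stage 2 of the Hodge ladder) — count-neutral KERNEL COMBINATORICS «β − 1 faces for every Galois CM field whose Galois group
has a cyclic subgroup of index two containing complex conjugation, split by an involution whose odd coset carries conjugation — the modular and
semidihedral closures» (seat prover-pub-hodgecm2-b23-g49-0, binder prover b23, gen 49; own census lane INDEX-TWO CYCLIC LAW, claim HOME/INBOX.md l.22678).
Theorems only; no geometry beyond the treeʼs `Face`, no `Universe` field touched, no named fact, nothing asserted; the lane `Census/IndexTwoCyclic*` (this
seat; parts I–VI), the generic transfer `CorCM/FaceGenerationTransfer.lean` and the INT2-GEN socket (`CorCM/FacePeriodsGeneratingSet.lean`) are used BY NAME;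
`Interfaces.lean` (C1), every E term, B01, `Transposition/*`, `PortJoin/*`, `D2Bridge/*` are untouched.
HONEST FRAMING (COORDINATOR RULING — HODGE FRAMING CORRECTION, 2026-08-21T11:55:35Z): `HC_CM` is NOT proved, here or anywhere in the tree; this file
produces no period and proves no face period for any field; its `HodgeConjectureFor` statement is CONDITIONAL on face periods.
T5: n/a-class — the only Prop hypothesis binders displayed are the index-two cyclic datum (inhabited: `Census/IndexTwoCyclicInstance.lean`, the semidirect
products `ℤ/2n ⋊_r ℤ/2`), `Even n`, the twist hypothesis `conjT ∈ ⟨u^{r+1}⟩` (inhabited there by the semidihedral-type and modular-type groups) and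
INT2-GENʼs period hypothesis on the produced face set (§3); no named-fact / conjecture-def binder; checker: self (prover-pub-hodgecm2-b23-g49-0), 2026-08-25.
-/
import Summits.HodgeConjecture.CorCM.Census.IndexTwoCyclicLaw
import Summits.HodgeConjecture.CorCM.Census.IndexTwoCyclicBlockCount
import Summits.HodgeConjecture.CorCM.Census.IndexTwoCyclicSquareTwist
import Summits.HodgeConjecture.CorCM.FaceGenerationTransfer
import Summits.HodgeConjecture.CorCM.FaceCensusOddSliceTransport
import HarnessLib

/-!
# Galois CM fields with group `ℤ/2n ⋊_r ℤ/2`, conjugation `uⁿ`, `c ∈ ⟨u^{r+1}⟩` (modular / semidihedral closures): EXACTLY `β − 1 = φ₂` generating faces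

Let `F` be a Galois CM field whose Galois translates `GalT F` carry an INDEX-TWO CYCLIC DATUM (`Census/IndexTwoCyclicDatum.lean`,
`IndexTwoCyclic.Datum (GalT F) conjT n`): a translate `u` of order `2n` with `uⁿ = conjT` generating a subgroup of index two, and an involution `w`
outside it with `w·u = uʳ·w` — i.e. `Gal(F/ℚ) ≅ ℤ/2n ⋊_r ℤ/2` (`[F:ℚ] = 4n`) with complex conjugation the involution of the cyclic subgroup: the
dihedral (`r = −1`, seat b23 gen 48), abelian (`r = 1`, seat b09), MODULAR (`r = n + 1`: `M₁₆` in degree `16`, `M₃₂` in degree `32`, …), SEMIDIHEDRAL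
(`r = n − 1`: `SD₁₆`, `SD₃₂`, …) closures and their mixed relatives (`M₁₆ × ℤ/3`, `SD₁₆ × ℤ/3` in degree `48`, …).  Write `β(F) = #Block conjT`.

* §1 **`exists_faces_hgen_of_indexTwoCyclic`** (EVERY twist `r`): a face set `𝒮` with `|𝒮| + 1 ≤ β(F)` satisfying INT2-GENʼs generation binder
  `hgen(𝒮, σ₀)` exists.  **`isLeast_card_faces_hgen_of_twist`**: if `n` is even and `conjT ∈ ⟨u^{r+1}⟩` (modular, semidihedral, …: `v₂(r+1) < v₂(2n)`)
  the least size of such a face set is **EXACTLY `φ₂(F) = β(F) − 1`** (`…_card_block`); the `H₂`-form (`isLeast_card_faces_hgen_of_indexTwo_powers`)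
  asks instead for an index-two subgroup `H₂ ∋ conjT` of `GalT F` all of whose outside elements have `conjT` among their powers (field side: a
  quadratic subfield `k ⊂ F` fixed by conjugation such that every automorphism moving `k` has a power equal to complex conjugation); rows: degree `16`
  modular closure (`M₁₆`) EXACTLY `17`, semidihedral closure (`SD₁₆`) EXACTLY `19`; degree `32`: `M₃₂` `2063`, `SD₃₂` `2111` (`Census/IndexTwoCyclicBlockCount.lean`).
* §2 the degree (`four_mul_eq_finrank`) and **the datum from the automorphism group** (`exists_datum_of_aut`): `u₀ ∈ Aut(F)` of order `2n` with `u₀ⁿ`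
  inducing complex conjugation at `σ₀`, an involution `w₀ ∉ ⟨u₀⟩` with `w₀·u₀ = u₀ʳ·w₀`, `[F:ℚ] = 4n` — with the fields `u, w, r` of the datum
  identified, so that the twist hypothesis transfers (`isLeast_card_faces_hgen_of_aut`).
* §3 **`hodgeConjectureFor_of_twist_of_exists_facePeriod`** (INT2-GEN socket BY NAME, `n ≥ 2`): a face set with `|𝒮| = φ₂(F)` EXISTS whose periods on
  the universe of record give the Hodge conjecture for every abelian variety dominated by a product of CM abelian varieties with CM by subfields of
  `F` — CONDITIONAL on those periods; `HC_CM` is NOT proved.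

References: [cite: Pohlmann1968, Thm. 1]; [cite: Milne1999LefschetzClasses, Thm. 3.2, Prop. 2.1]; [cite: Shimura1998, §6.2 Theorem 3 and §6.1
Corollary of Theorem 2 (pp. 41–43), §8.1 (p. 62)]; [cite: MumfordAV1970, §19 Thm. 1 and p. 169].
-/

noncomputable section

open CategoryTheory NumberField NumberField.ComplexEmbedding
open Literature.AlgebraicGeometry Literature.AlgebraicGeometry.Motives Literature.AlgebraicGeometry.HodgeTheory
open Literature.AlgebraicGeometry.ComplexMultiplication Literature.AlgebraicGeometry.Milne1999
open Literature.NumberTheory.Automorphic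
open Literature.NumberTheory.Automorphic.PicardCM
open Summit.HodgeConjecture.CorCM.Domination

namespace Summit.HodgeConjecture.CorCM.FaceIndexTwoCyclic

open Summit.HodgeConjecture.CorCM.Prior.AllgGroup.RfwfAllgGroup
open Summit.HodgeConjecture.CorCM.Census.BlockParity
open Summit.HodgeConjecture.CorCM.Census.Coinvariant
open Summit.HodgeConjecture.CorCM.Census
open Summit.HodgeConjecture.CorCM.FaceCensus.OddSlice (galTOfAut galTOfAut_mul galTOfAut_conjAut)

/-! ## §1 Index-two cyclic datum on the Galois translates: `β(F) − 1` faces generate; exactly `φ₂(F) = β(F) − 1` under the twist hypothesis -/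

section Field

variable {F : Type} [Field F] [NumberField F] {n : ℕ} [NeZero n]

/-- Complex conjugation is central in `GalT F` along the datum (from `comm_pow_n`; file-local). [folklore] -/
private theorem conjT_comm (D : IndexTwoCyclic.Datum (GalT F) conjT n) (y : GalT F) : y * conjT = conjT * y := by
  have h := D.comm_pow_n y
  rwa [D.hun] at h

/-- **EVERY GALOIS CM FIELD WITH GROUP `ℤ/2n ⋊_r ℤ/2` AND CONJUGATION `uⁿ` HAS A GENERATING FACE SET OF SIZE AT MOST `β(F) − 1`**, for every
twist `r`. [folklore] -/
theorem exists_faces_hgen_of_indexTwoCyclic [IsCMField F] [IsGalois ℚ F] (D : IndexTwoCyclic.Datum (GalT F) conjT n) (σ₀ : F →+* ℂ) :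
    ∃ 𝒮 : Finset (Face F), 𝒮.card + 1 ≤ Fintype.card (Block (conjT : GalT F)) ∧
      ∀ f : Face F, lefChar f.corner (fun _ => ({σ₀} : Finset (F →+* ℂ))) ∈ AddSubgroup.closure
        {a : Asym F | ∃ g ∈ (𝒮 : Set (Face F)), ∃ σ : F →+* ℂ, a = lefChar g.corner (fun _ => ({σ} : Finset (F →+* ℂ)))} := by
  obtain ⟨S, hS, hcard, hgen⟩ := IndexTwoCyclic.exists_gfaces_generate D conjT_mul_self
  obtain ⟨𝒮, h𝒮, h⟩ := FaceTransfer.exists_faces_hgen_of_generate σ₀ S hS hgen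
  exact ⟨𝒮, by omega, h⟩

/-- **EXACTLY `φ₂(F)` GENERATING FACES along an index-two subgroup `H₂ ∋ conjT` whose outside elements carry `conjT` among their powers.** [folklore] -/
theorem isLeast_card_faces_hgen_of_indexTwo_powers [IsCMField F] [IsGalois ℚ F] (D : IndexTwoCyclic.Datum (GalT F) conjT n)
    (H₂ : Subgroup (GalT F)) (hH₂ : H₂.index = 2) (hcH : conjT ∈ H₂) (hout : ∀ y : GalT F, y ∉ H₂ → conjT ∈ Subgroup.zpowers y) (σ₀ : F →+* ℂ) :
    IsLeast {m : ℕ | ∃ 𝒮 : Finset (Face F), 𝒮.card = m ∧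
      ∀ f : Face F, lefChar f.corner (fun _ => ({σ₀} : Finset (F →+* ℂ))) ∈ AddSubgroup.closure
        {a : Asym F | ∃ g ∈ (𝒮 : Set (Face F)), ∃ σ : F →+* ℂ, a = lefChar g.corner (fun _ => ({σ} : Finset (F →+* ℂ)))}}
      (fibreTwo (conjT : GalT F) conjT_mul_self) := by
  refine FaceTransfer.isLeast_card_faces_hgen_of_intrinsic _ ?_ (fun S₀ hS₀ hS => ?_) σ₀
  · obtain ⟨S, hS, hcard, hgen⟩ := (IndexTwoCyclic.isLeast_card_gfaces_generate_fibreTwo D conjT_mul_self conjT_ne_one H₂ hH₂ hcH hout).1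
    exact ⟨S, hS, hcard.le, hgen⟩
  · exact fibreTwo_le_card conjT conjT_mul_self (conjT_comm D) S₀ (Submodule.span ℤ (pairSet conjT)) le_rfl hS₀
      (fun y hy => hS (gfaceSet_subset_hodgeSpan conjT conjT_mul_self hy))

/-- **EVERY GALOIS CM FIELD WITH GROUP `ℤ/2n ⋊_r ℤ/2`, CONJUGATION `uⁿ`, `n` EVEN AND `conjT ∈ ⟨u^{r+1}⟩` (modular, semidihedral, … closures) HAS
`φ₂(F)` GENERATING FACES, AND NONE FEWER** — the coinvariant floor is attained. [folklore] -/
theorem isLeast_card_faces_hgen_of_twist [IsCMField F] [IsGalois ℚ F] (D : IndexTwoCyclic.Datum (GalT F) conjT n) (hn : Even n)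
    (hr : (conjT : GalT F) ∈ Subgroup.zpowers (D.u ^ (D.r + 1))) (σ₀ : F →+* ℂ) :
    IsLeast {m : ℕ | ∃ 𝒮 : Finset (Face F), 𝒮.card = m ∧
      ∀ f : Face F, lefChar f.corner (fun _ => ({σ₀} : Finset (F →+* ℂ))) ∈ AddSubgroup.closure
        {a : Asym F | ∃ g ∈ (𝒮 : Set (Face F)), ∃ σ : F →+* ℂ, a = lefChar g.corner (fun _ => ({σ} : Finset (F →+* ℂ)))}}
      (fibreTwo (conjT : GalT F) conjT_mul_self) := by
  refine FaceTransfer.isLeast_card_faces_hgen_of_intrinsic _ ?_ (fun S₀ hS₀ hS => ?_) σ₀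
  · obtain ⟨S, hS, hcard, hgen⟩ := (IndexTwoCyclic.isLeast_card_gfaces_generate_fibreTwo_of_twist D conjT_mul_self conjT_ne_one hn hr).1
    exact ⟨S, hS, hcard.le, hgen⟩
  · exact fibreTwo_le_card conjT conjT_mul_self (conjT_comm D) S₀ (Submodule.span ℤ (pairSet conjT)) le_rfl hS₀
      (fun y hy => hS (gfaceSet_subset_hodgeSpan conjT conjT_mul_self hy))

/-- **Block currency: EXACTLY `β(F) − 1` generating faces** under the twist hypothesis. [folklore] -/
theorem isLeast_card_faces_hgen_of_twist_card_block [IsCMField F] [IsGalois ℚ F] (D : IndexTwoCyclic.Datum (GalT F) conjT n) (hn : Even n)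
    (hr : (conjT : GalT F) ∈ Subgroup.zpowers (D.u ^ (D.r + 1))) (σ₀ : F →+* ℂ) :
    IsLeast {m : ℕ | ∃ 𝒮 : Finset (Face F), 𝒮.card = m ∧
      ∀ f : Face F, lefChar f.corner (fun _ => ({σ₀} : Finset (F →+* ℂ))) ∈ AddSubgroup.closure
        {a : Asym F | ∃ g ∈ (𝒮 : Set (Face F)), ∃ σ : F →+* ℂ, a = lefChar g.corner (fun _ => ({σ} : Finset (F →+* ℂ)))}}
      (Fintype.card (Block (conjT : GalT F)) - 1) := by
  rw [IndexTwoCyclic.card_block_eq_fibreTwo_add_one_of_twist D conjT_mul_self conjT_ne_one hn hr, Nat.add_sub_cancel]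
  exact isLeast_card_faces_hgen_of_twist D hn hr σ₀

/-! ### Rows: the modular and semidihedral closures of degree `16` and `32` -/

/-- The twist hypothesis at level `4` from `r + 1 ≡ 6 (mod 8)` (modular closure `M₁₆`): `(u⁶)² = u⁴ = conjT`. [folklore] -/
theorem conjT_mem_zpowers_of_level_four_six [IsGalois ℚ F] (D : IndexTwoCyclic.Datum (GalT F) conjT 4)
    (hr : ((D.r + 1 : ℕ) : ZMod (2 * 4)) = 6) : (conjT : GalT F) ∈ Subgroup.zpowers (D.u ^ (D.r + 1)) := by
  have e : D.u ^ (D.r + 1) = D.u ^ 6 := by rw [D.pow_eq_pow_iff, hr, Nat.cast_ofNat]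
  rw [e, Subgroup.mem_zpowers_iff]
  refine ⟨2, ?_⟩
  rw [zpow_ofNat, ← pow_mul, show 6 * 2 = 2 * 4 + 4 from rfl, pow_add, D.pow_two_mul, one_mul, D.hun]

/-- The twist hypothesis at level `4` from `r + 1 ≡ 4 (mod 8)` (semidihedral closure `SD₁₆`): `u⁴ = conjT`. [folklore] -/
theorem conjT_mem_zpowers_of_level_four_four [IsGalois ℚ F] (D : IndexTwoCyclic.Datum (GalT F) conjT 4)
    (hr : ((D.r + 1 : ℕ) : ZMod (2 * 4)) = 4) : (conjT : GalT F) ∈ Subgroup.zpowers (D.u ^ (D.r + 1)) := by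
  have e : D.u ^ (D.r + 1) = D.u ^ 4 := by rw [D.pow_eq_pow_iff, hr, Nat.cast_ofNat]
  rw [e, D.hun]
  exact Subgroup.mem_zpowers _

/-- The twist hypothesis at level `8` from `r + 1 ≡ 10 (mod 16)` (modular closure `M₃₂`): `(u¹⁰)⁴ = u⁸ = conjT`. [folklore] -/
theorem conjT_mem_zpowers_of_level_eight_ten [IsGalois ℚ F] (D : IndexTwoCyclic.Datum (GalT F) conjT 8)
    (hr : ((D.r + 1 : ℕ) : ZMod (2 * 8)) = 10) : (conjT : GalT F) ∈ Subgroup.zpowers (D.u ^ (D.r + 1)) := by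
  have e : D.u ^ (D.r + 1) = D.u ^ 10 := by rw [D.pow_eq_pow_iff, hr, Nat.cast_ofNat]
  rw [e, Subgroup.mem_zpowers_iff]
  refine ⟨4, ?_⟩
  rw [zpow_ofNat, ← pow_mul, show 10 * 4 = 2 * 8 + (2 * 8 + 8) from rfl, pow_add, pow_add, D.pow_two_mul, one_mul, one_mul, D.hun]

/-- The twist hypothesis at level `8` from `r + 1 ≡ 8 (mod 16)` (semidihedral closure `SD₃₂`): `u⁸ = conjT`. [folklore] -/
theorem conjT_mem_zpowers_of_level_eight_eight [IsGalois ℚ F] (D : IndexTwoCyclic.Datum (GalT F) conjT 8)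
    (hr : ((D.r + 1 : ℕ) : ZMod (2 * 8)) = 8) : (conjT : GalT F) ∈ Subgroup.zpowers (D.u ^ (D.r + 1)) := by
  have e : D.u ^ (D.r + 1) = D.u ^ 8 := by rw [D.pow_eq_pow_iff, hr, Nat.cast_ofNat]
  rw [e, D.hun]
  exact Subgroup.mem_zpowers _

/-- **Degree `16`, modular closure `M₁₆`** (level `4`, `r + 1 ≡ 6 (mod 8)`): EXACTLY `17` generating faces. [folklore] -/
theorem isLeast_card_faces_hgen_seventeen [IsCMField F] [IsGalois ℚ F] (D : IndexTwoCyclic.Datum (GalT F) conjT 4)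
    (hr : ((D.r + 1 : ℕ) : ZMod (2 * 4)) = 6) (σ₀ : F →+* ℂ) :
    IsLeast {m : ℕ | ∃ 𝒮 : Finset (Face F), 𝒮.card = m ∧
      ∀ f : Face F, lefChar f.corner (fun _ => ({σ₀} : Finset (F →+* ℂ))) ∈ AddSubgroup.closure
        {a : Asym F | ∃ g ∈ (𝒮 : Set (Face F)), ∃ σ : F →+* ℂ, a = lefChar g.corner (fun _ => ({σ} : Finset (F →+* ℂ)))}} 17 := by
  have h := isLeast_card_faces_hgen_of_twist_card_block D ⟨2, rfl⟩ (conjT_mem_zpowers_of_level_four_six D hr) σ₀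
  rw [IndexTwoCyclic.card_block_eq_eighteen D conjT_mul_self conjT_ne_one hr] at h
  exact h

/-- **Degree `16`, semidihedral closure `SD₁₆`** (level `4`, `r + 1 ≡ 4 (mod 8)`): EXACTLY `19` generating faces. [folklore] -/
theorem isLeast_card_faces_hgen_nineteen [IsCMField F] [IsGalois ℚ F] (D : IndexTwoCyclic.Datum (GalT F) conjT 4)
    (hr : ((D.r + 1 : ℕ) : ZMod (2 * 4)) = 4) (σ₀ : F →+* ℂ) :
    IsLeast {m : ℕ | ∃ 𝒮 : Finset (Face F), 𝒮.card = m ∧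
      ∀ f : Face F, lefChar f.corner (fun _ => ({σ₀} : Finset (F →+* ℂ))) ∈ AddSubgroup.closure
        {a : Asym F | ∃ g ∈ (𝒮 : Set (Face F)), ∃ σ : F →+* ℂ, a = lefChar g.corner (fun _ => ({σ} : Finset (F →+* ℂ)))}} 19 := by
  have h := isLeast_card_faces_hgen_of_twist_card_block D ⟨2, rfl⟩ (conjT_mem_zpowers_of_level_four_four D hr) σ₀
  rw [IndexTwoCyclic.card_block_eq_twenty D conjT_mul_self conjT_ne_one hr] at h
  exact h

/-- **Degree `32`, modular closure `M₃₂`** (level `8`, `r + 1 ≡ 10 (mod 16)`): EXACTLY `2063` generating faces. [folklore] -/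
theorem isLeast_card_faces_hgen_2063 [IsCMField F] [IsGalois ℚ F] (D : IndexTwoCyclic.Datum (GalT F) conjT 8)
    (hr : ((D.r + 1 : ℕ) : ZMod (2 * 8)) = 10) (σ₀ : F →+* ℂ) :
    IsLeast {m : ℕ | ∃ 𝒮 : Finset (Face F), 𝒮.card = m ∧
      ∀ f : Face F, lefChar f.corner (fun _ => ({σ₀} : Finset (F →+* ℂ))) ∈ AddSubgroup.closure
        {a : Asym F | ∃ g ∈ (𝒮 : Set (Face F)), ∃ σ : F →+* ℂ, a = lefChar g.corner (fun _ => ({σ} : Finset (F →+* ℂ)))}} 2063 := by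
  have h := isLeast_card_faces_hgen_of_twist_card_block D ⟨4, rfl⟩ (conjT_mem_zpowers_of_level_eight_ten D hr) σ₀
  rw [IndexTwoCyclic.card_block_eq_2064 D conjT_mul_self conjT_ne_one hr] at h
  exact h

/-- **Degree `32`, semidihedral closure `SD₃₂`** (level `8`, `r + 1 ≡ 8 (mod 16)`): EXACTLY `2111` generating faces. [folklore] -/
theorem isLeast_card_faces_hgen_2111 [IsCMField F] [IsGalois ℚ F] (D : IndexTwoCyclic.Datum (GalT F) conjT 8)
    (hr : ((D.r + 1 : ℕ) : ZMod (2 * 8)) = 8) (σ₀ : F →+* ℂ) :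
    IsLeast {m : ℕ | ∃ 𝒮 : Finset (Face F), 𝒮.card = m ∧
      ∀ f : Face F, lefChar f.corner (fun _ => ({σ₀} : Finset (F →+* ℂ))) ∈ AddSubgroup.closure
        {a : Asym F | ∃ g ∈ (𝒮 : Set (Face F)), ∃ σ : F →+* ℂ, a = lefChar g.corner (fun _ => ({σ} : Finset (F →+* ℂ)))}} 2111 := by
  have h := isLeast_card_faces_hgen_of_twist_card_block D ⟨4, rfl⟩ (conjT_mem_zpowers_of_level_eight_eight D hr) σ₀
  rw [IndexTwoCyclic.card_block_eq_2112 D conjT_mul_self conjT_ne_one hr] at h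
  exact h

/-! ## §2 The degree; the datum from the automorphism group -/

omit [NeZero n] in
/-- **`4n` is the degree of a field with an index-two cyclic datum at level `n`.** [folklore] -/
theorem four_mul_eq_finrank [IsGalois ℚ F] (D : IndexTwoCyclic.Datum (GalT F) conjT n) : 4 * n = Module.finrank ℚ F := by
  have h := (Subgroup.zpowers D.u).card_mul_index
  rw [Nat.card_zpowers, D.hord, D.hindex, Nat.card_eq_fintype_card, FaceCensus.card_galT] at h
  omega

omit [NeZero n] in
/-- Such a field has degree at least `8` when `n ≥ 2`. [folklore] -/
private theorem eight_le_finrank [IsGalois ℚ F] (D : IndexTwoCyclic.Datum (GalT F) conjT n) (h2 : 2 ≤ n) : 8 ≤ Module.finrank ℚ F := by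
  rw [← four_mul_eq_finrank D]; omega

/-- **The index-two cyclic datum from an `Aut`-datum**, with its fields identified: an automorphism `u₀` of order `2n` whose `n`-th power induces complex
conjugation at `σ₀`, an involution `w₀ ∉ ⟨u₀⟩` with `w₀·u₀ = u₀ʳ·w₀`, in a field of degree `4n`. [folklore] -/
theorem exists_datum_of_aut [IsGalois ℚ F] (σ₀ : F →+* ℂ) (u₀ w₀ : F ≃ₐ[ℚ] F) (r : ℕ) (hord : orderOf u₀ = 2 * n)
    (hcσ : σ₀.comp ((u₀ ^ n : F ≃ₐ[ℚ] F) : F →+* F) = conjugate σ₀) (hw : w₀ ∉ Subgroup.zpowers u₀) (hww : w₀ * w₀ = 1)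
    (htwist : w₀ * u₀ = u₀ ^ r * w₀) (hdeg : Module.finrank ℚ F = 4 * n) :
    ∃ D : IndexTwoCyclic.Datum (GalT F) conjT n, D.u = galTOfAut σ₀ u₀ ∧ D.w = galTOfAut σ₀ w₀ ∧ D.r = r := by
  -- the multiplicative equivalence `Aut(F) ≃* GalT F` at `σ₀`
  set e : (F ≃ₐ[ℚ] F) ≃* GalT F := MulEquiv.mk' (galTOfAut σ₀) (galTOfAut_mul σ₀) with he
  have he_apply : ∀ x, e x = galTOfAut σ₀ x := fun x => rfl
  have hmem : ∀ x : F ≃ₐ[ℚ] F, e x ∈ Subgroup.zpowers (e u₀) ↔ x ∈ Subgroup.zpowers u₀ := by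
    intro x
    constructor
    · intro h
      obtain ⟨k, hk⟩ := Subgroup.mem_zpowers_iff.mp h
      rw [← map_zpow, e.apply_eq_iff_eq] at hk
      exact Subgroup.mem_zpowers_iff.mpr ⟨k, hk⟩
    · intro h
      obtain ⟨k, hk⟩ := Subgroup.mem_zpowers_iff.mp h
      exact Subgroup.mem_zpowers_iff.mpr ⟨k, by rw [← map_zpow, hk]⟩
  have hord' : orderOf (e u₀) = 2 * n := by
    rw [← hord]; exact orderOf_injective e.toMonoidHom e.injective u₀
  have hindex : (Subgroup.zpowers (e u₀)).index = 2 := by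
    have h := (Subgroup.zpowers (e u₀)).card_mul_index
    rw [Nat.card_zpowers, hord', Nat.card_eq_fintype_card, FaceCensus.card_galT, hdeg] at h
    have hn : 0 < 2 * n := by have := NeZero.ne n; omega
    have e2 : 2 * n * (Subgroup.zpowers (e u₀)).index = 2 * n * 2 := by rw [h]; ring
    exact Nat.eq_of_mul_eq_mul_left hn e2
  have hun : e u₀ ^ n = conjT := by
    rw [← map_pow, he_apply]
    exact galTOfAut_conjAut σ₀ hcσ
  have hww' : e w₀ * e w₀ = 1 := by rw [← map_mul, hww, map_one]
  have htwist' : e w₀ * e u₀ = e u₀ ^ r * e w₀ := by rw [← map_mul, htwist, map_mul, map_pow]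
  have hw' : e w₀ ∉ Subgroup.zpowers (e u₀) := fun h => hw ((hmem w₀).mp h)
  exact ⟨⟨e u₀, e w₀, r, hun, hord', hindex, hw', hww', htwist'⟩, rfl, rfl, rfl⟩

/-- **EXACTLY `φ₂(F)` GENERATING FACES from an `Aut`-datum**: `u₀, w₀` as above, `n` even, and the conjugation automorphism `u₀ⁿ` among the powers of
`u₀^{r+1}` (modular closures: `r = n + 1`, `4 ∣ n`; semidihedral closures: `r = n − 1`). [folklore] -/
theorem isLeast_card_faces_hgen_of_aut [IsCMField F] [IsGalois ℚ F] (σ₀ : F →+* ℂ) (u₀ w₀ : F ≃ₐ[ℚ] F) (r : ℕ) (hord : orderOf u₀ = 2 * n)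
    (hcσ : σ₀.comp ((u₀ ^ n : F ≃ₐ[ℚ] F) : F →+* F) = conjugate σ₀) (hw : w₀ ∉ Subgroup.zpowers u₀) (hww : w₀ * w₀ = 1)
    (htwist : w₀ * u₀ = u₀ ^ r * w₀) (hdeg : Module.finrank ℚ F = 4 * n) (hn : Even n)
    (hr : u₀ ^ n ∈ Subgroup.zpowers (u₀ ^ (r + 1))) :
    IsLeast {m : ℕ | ∃ 𝒮 : Finset (Face F), 𝒮.card = m ∧
      ∀ f : Face F, lefChar f.corner (fun _ => ({σ₀} : Finset (F →+* ℂ))) ∈ AddSubgroup.closure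
        {a : Asym F | ∃ g ∈ (𝒮 : Set (Face F)), ∃ σ : F →+* ℂ, a = lefChar g.corner (fun _ => ({σ} : Finset (F →+* ℂ)))}}
      (fibreTwo (conjT : GalT F) conjT_mul_self) := by
  obtain ⟨D, hu, -, hDr⟩ := exists_datum_of_aut σ₀ u₀ w₀ r hord hcσ hw hww htwist hdeg
  refine isLeast_card_faces_hgen_of_twist D hn ?_ σ₀
  -- transport `u₀ⁿ ∈ ⟨u₀^{r+1}⟩` along `galTOfAut σ₀`
  obtain ⟨k, hk⟩ := Subgroup.mem_zpowers_iff.mp hr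
  rw [hu, hDr, Subgroup.mem_zpowers_iff]
  refine ⟨k, ?_⟩
  set e : (F ≃ₐ[ℚ] F) ≃* GalT F := MulEquiv.mk' (galTOfAut σ₀) (galTOfAut_mul σ₀) with he
  have he_apply : ∀ x, e x = galTOfAut σ₀ x := fun x => rfl
  have h1 : e ((u₀ ^ (r + 1)) ^ k) = e (u₀ ^ n) := by rw [hk]
  rw [map_zpow, map_pow, he_apply, he_apply, galTOfAut_conjAut σ₀ hcσ] at h1
  exact h1

end Field

/-! ## §3 The Hodge-conjecture reading through the INT2-GEN socket (conditional on the face periods) -/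

variable {n : ℕ} [NeZero n]

/-- **HC for the slice of a Galois CM field with group `ℤ/2n ⋊_r ℤ/2`, conjugation `uⁿ`, `n` even, `conjT ∈ ⟨u^{r+1}⟩`, from `φ₂ = β − 1` face periods**
(INT2-GEN socket BY NAME; `n ≥ 2`; CONDITIONAL on the periods — `HC_CM` is NOT proved): there is a face set `𝒮` with `|𝒮| = φ₂(K) = β(K) − 1` (none
fewer can satisfy the generation binder) such that, if every face of `𝒮` has a non-vanishing period on the universe of record, the Hodge conjecture holds
for every abelian variety dominated by a product of CM abelian varieties with CM by subfields of `K`.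
[cite: Shimura1998, §6.2 Theorem 3 and §6.1 Corollary of Theorem 2 (pp. 41–43)] [cite: Pohlmann1968, Thm. 1]
[cite: Milne1999LefschetzClasses, Thm. 3.2 and Cor. 4.5] [cite: MumfordAV1970, §19 Thm. 1 and p. 169] -/
theorem hodgeConjectureFor_of_twist_of_exists_facePeriod (K : CMField) [hGal : IsGalois ℚ K]
    (D : IndexTwoCyclic.Datum (GalT K) conjT n) (hn : Even n) (hr : (conjT : GalT K) ∈ Subgroup.zpowers (D.u ^ (D.r + 1))) (h2 : 2 ≤ n)
    (σ₀ : (K : Type) →+* ℂ) :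
    ∃ 𝒮 : Finset (Face K), 𝒮.card = fibreTwo (conjT : GalT K) conjT_mul_self ∧
      ((∀ f ∈ 𝒮, ∃ ι₁ : K →+* ℂ, f.Admissible ι₁ ∧ ∃ (V : HermSpace3 K ι₁) (σ : K →+* ℂ),
        (Model.picardCMUniverse exists_isReal_hodgeModel_holds hodgePQ_independent_of_hodgeModel_holds
          BallQuotient.ballQuotientUniformised_holds cmAbelianVarietyRealised_holds).PeriodNV ι₁ V K f.psi σ) →
      ∀ {P B : AbelianVariety ℂ}, AbelianVariety.IsProductOf (fun B : AbelianVariety ℂ =>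
        ∃ (E : Type) (_ : Field E) (_ : NumberField E) (_ : IsCMField E) (_ : E →+* (K : Type)) (Φ : CMType E)
          (ι : 𝓞 E →+* End B) (ϑ : E →+* Module.End ℂ (complexBetti B.X 1)),
          IsCMTypeRealisation Φ B ι ϑ) P →
      AVDominatedBy B P → HodgeConjectureFor B.dim B.X) := by
  obtain ⟨⟨𝒮, hcard, hgen⟩, -⟩ := isLeast_card_faces_hgen_of_twist (F := K) D hn hr σ₀
  refine ⟨𝒮, hcard, fun h P B hP hB => ?_⟩
  have h6 : 6 ≤ Module.finrank ℚ K := le_trans (by norm_num) (eight_le_finrank (F := K) D h2)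
  exact hodgeConjectureFor_of_avDominatedBy_isProductOf_of_exists_facePeriod_on K h6 (𝒮 : Set (Face K)) σ₀ hgen
    (fun f hf => h f (Finset.mem_coe.mp hf)) hP hB

/-- **HC for the slice from `β − 1` face periods, EVERY twist `r`** (no parity / twist hypothesis; INT2-GEN socket BY NAME; `n ≥ 2`; CONDITIONAL on the
periods — `HC_CM` is NOT proved). [folklore] -/
theorem hodgeConjectureFor_of_indexTwoCyclic_of_exists_facePeriod (K : CMField) [hGal : IsGalois ℚ K]
    (D : IndexTwoCyclic.Datum (GalT K) conjT n) (h2 : 2 ≤ n) (σ₀ : (K : Type) →+* ℂ) :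
    ∃ 𝒮 : Finset (Face K), 𝒮.card + 1 ≤ Fintype.card (Block (conjT : GalT K)) ∧
      ((∀ f ∈ 𝒮, ∃ ι₁ : K →+* ℂ, f.Admissible ι₁ ∧ ∃ (V : HermSpace3 K ι₁) (σ : K →+* ℂ),
        (Model.picardCMUniverse exists_isReal_hodgeModel_holds hodgePQ_independent_of_hodgeModel_holds
          BallQuotient.ballQuotientUniformised_holds cmAbelianVarietyRealised_holds).PeriodNV ι₁ V K f.psi σ) →
      ∀ {P B : AbelianVariety ℂ}, AbelianVariety.IsProductOf (fun B : AbelianVariety ℂ =>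
        ∃ (E : Type) (_ : Field E) (_ : NumberField E) (_ : IsCMField E) (_ : E →+* (K : Type)) (Φ : CMType E)
          (ι : 𝓞 E →+* End B) (ϑ : E →+* Module.End ℂ (complexBetti B.X 1)),
          IsCMTypeRealisation Φ B ι ϑ) P →
      AVDominatedBy B P → HodgeConjectureFor B.dim B.X) := by
  obtain ⟨𝒮, hcard, hgen⟩ := exists_faces_hgen_of_indexTwoCyclic (F := K) D σ₀
  refine ⟨𝒮, hcard, fun h P B hP hB => ?_⟩
  have h6 : 6 ≤ Module.finrank ℚ K := le_trans (by norm_num) (eight_le_finrank (F := K) D h2)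
  exact hodgeConjectureFor_of_avDominatedBy_isProductOf_of_exists_facePeriod_on K h6 (𝒮 : Set (Face K)) σ₀ hgen
    (fun f hf => h f (Finset.mem_coe.mp hf)) hP hB

end Summit.HodgeConjecture.CorCM.FaceIndexTwoCyclic

end

/-! ## §4 (appendix, twist-free) The law from `u₀, w₀ ∈ Aut(F)` alone: `conj = u₀ⁿ ∈ ⟨(w₀·u₀)²⟩` -/

open CategoryTheory NumberField NumberField.ComplexEmbedding
open Literature.AlgebraicGeometry Literature.AlgebraicGeometry.Motives Literature.AlgebraicGeometry.HodgeTheory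
open Literature.AlgebraicGeometry.ComplexMultiplication Literature.AlgebraicGeometry.Milne1999
open Literature.NumberTheory.Automorphic
open Literature.NumberTheory.Automorphic.PicardCM
open Summit.HodgeConjecture.CorCM.Domination

namespace Summit.HodgeConjecture.CorCM.FaceIndexTwoCyclic

open Summit.HodgeConjecture.CorCM.Prior.AllgGroup.RfwfAllgGroup
open Summit.HodgeConjecture.CorCM.Census.BlockParity
open Summit.HodgeConjecture.CorCM.Census.Coinvariant
open Summit.HodgeConjecture.CorCM.Census
open Summit.HodgeConjecture.CorCM.FaceCensus.OddSlice (galTOfAut galTOfAut_mul galTOfAut_conjAut)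

variable {F : Type} [Field F] [NumberField F] {n : ℕ} [NeZero n]

/-- **The index-two cyclic datum from `u₀, w₀ ∈ Aut(F)` alone** (no twisting exponent supplied): `u₀` of order `2n` with `u₀ⁿ` inducing complex
conjugation at `σ₀`, an involution `w₀ ∉ ⟨u₀⟩`, `[F:ℚ] = 4n`; the twist hypothesis `u₀ⁿ ∈ ⟨(w₀·u₀)²⟩` transports to the datum. [folklore] -/
theorem exists_datum_of_aut_involution [IsGalois ℚ F] (σ₀ : F →+* ℂ) (u₀ w₀ : F ≃ₐ[ℚ] F) (hord : orderOf u₀ = 2 * n)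
    (hcσ : σ₀.comp ((u₀ ^ n : F ≃ₐ[ℚ] F) : F →+* F) = conjugate σ₀) (hw : w₀ ∉ Subgroup.zpowers u₀) (hww : w₀ * w₀ = 1)
    (hdeg : Module.finrank ℚ F = 4 * n) :
    ∃ D : IndexTwoCyclic.Datum (GalT F) conjT n, D.u = galTOfAut σ₀ u₀ ∧ D.w = galTOfAut σ₀ w₀ ∧
      (u₀ ^ n ∈ Subgroup.zpowers ((w₀ * u₀) ^ 2) → (conjT : GalT F) ∈ Subgroup.zpowers ((D.w * D.u) ^ 2)) := by
  set e : (F ≃ₐ[ℚ] F) ≃* GalT F := MulEquiv.mk' (galTOfAut σ₀) (galTOfAut_mul σ₀) with he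
  have he_apply : ∀ x, e x = galTOfAut σ₀ x := fun x => rfl
  have hmem : ∀ x : F ≃ₐ[ℚ] F, e x ∈ Subgroup.zpowers (e u₀) → x ∈ Subgroup.zpowers u₀ := fun x h => by
    obtain ⟨k, hk⟩ := Subgroup.mem_zpowers_iff.mp h
    rw [← map_zpow, e.apply_eq_iff_eq] at hk
    exact Subgroup.mem_zpowers_iff.mpr ⟨k, hk⟩
  have hord' : orderOf (e u₀) = 2 * n := by
    rw [← hord]; exact orderOf_injective e.toMonoidHom e.injective u₀
  have hindex : (Subgroup.zpowers (e u₀)).index = 2 := by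
    have h := (Subgroup.zpowers (e u₀)).card_mul_index
    rw [Nat.card_zpowers, hord', Nat.card_eq_fintype_card, FaceCensus.card_galT, hdeg] at h
    have hn : 0 < 2 * n := by have := NeZero.ne n; omega
    have e2 : 2 * n * (Subgroup.zpowers (e u₀)).index = 2 * n * 2 := by rw [h]; ring
    exact Nat.eq_of_mul_eq_mul_left hn e2
  have hun : e u₀ ^ n = conjT := by
    rw [← map_pow, he_apply]
    exact galTOfAut_conjAut σ₀ hcσ
  obtain ⟨D, hu, hwD⟩ := IndexTwoCyclic.exists_datum_of_involution (e u₀) (e w₀) hun hord' hindex (fun h => hw (hmem w₀ h))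
    (by rw [← map_mul, hww, map_one])
  refine ⟨D, hu, hwD, fun h => ?_⟩
  obtain ⟨k, hk⟩ := Subgroup.mem_zpowers_iff.mp h
  rw [hu, hwD, Subgroup.mem_zpowers_iff]
  refine ⟨k, ?_⟩
  have h1 : e (((w₀ * u₀) ^ 2) ^ k) = e (u₀ ^ n) := by rw [hk]
  rwa [map_zpow, map_pow, map_mul, map_pow, hun] at h1

/-- **EXACTLY `φ₂(F)` GENERATING FACES from `u₀, w₀ ∈ Aut(F)` alone**: `u₀` of order `2n`, `u₀ⁿ` = complex conjugation at `σ₀`, an involution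
`w₀ ∉ ⟨u₀⟩`, `[F:ℚ] = 4n`, `n` even, and conjugation among the powers of `(w₀·u₀)²` (modular / semidihedral closures and their mixed relatives); the
block currency `β(F) − 1` is `isLeast_card_faces_hgen_of_twist_card_block`. [folklore] -/
theorem isLeast_card_faces_hgen_of_aut_sq [IsCMField F] [IsGalois ℚ F] (σ₀ : F →+* ℂ) (u₀ w₀ : F ≃ₐ[ℚ] F) (hord : orderOf u₀ = 2 * n)
    (hcσ : σ₀.comp ((u₀ ^ n : F ≃ₐ[ℚ] F) : F →+* F) = conjugate σ₀) (hw : w₀ ∉ Subgroup.zpowers u₀) (hww : w₀ * w₀ = 1)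
    (hdeg : Module.finrank ℚ F = 4 * n) (hn : Even n) (h : u₀ ^ n ∈ Subgroup.zpowers ((w₀ * u₀) ^ 2)) :
    IsLeast {m : ℕ | ∃ 𝒮 : Finset (Face F), 𝒮.card = m ∧
      ∀ f : Face F, lefChar f.corner (fun _ => ({σ₀} : Finset (F →+* ℂ))) ∈ AddSubgroup.closure
        {a : Asym F | ∃ g ∈ (𝒮 : Set (Face F)), ∃ σ : F →+* ℂ, a = lefChar g.corner (fun _ => ({σ} : Finset (F →+* ℂ)))}}
      (fibreTwo (conjT : GalT F) conjT_mul_self) := by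
  obtain ⟨D, -, -, htw⟩ := exists_datum_of_aut_involution σ₀ u₀ w₀ hord hcσ hw hww hdeg
  exact isLeast_card_faces_hgen_of_twist D hn (by rw [← IndexTwoCyclic.w_mul_u_sq D]; exact htw h) σ₀

/-- **A generating face set of size at most `β(F) − 1` from `u₀, w₀ ∈ Aut(F)` alone**, every twist (no parity, no twist hypothesis). [folklore] -/
theorem exists_faces_hgen_of_aut_involution [IsCMField F] [IsGalois ℚ F] (σ₀ : F →+* ℂ) (u₀ w₀ : F ≃ₐ[ℚ] F) (hord : orderOf u₀ = 2 * n)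
    (hcσ : σ₀.comp ((u₀ ^ n : F ≃ₐ[ℚ] F) : F →+* F) = conjugate σ₀) (hw : w₀ ∉ Subgroup.zpowers u₀) (hww : w₀ * w₀ = 1)
    (hdeg : Module.finrank ℚ F = 4 * n) :
    ∃ 𝒮 : Finset (Face F), 𝒮.card + 1 ≤ Fintype.card (Block (conjT : GalT F)) ∧
      ∀ f : Face F, lefChar f.corner (fun _ => ({σ₀} : Finset (F →+* ℂ))) ∈ AddSubgroup.closure
        {a : Asym F | ∃ g ∈ (𝒮 : Set (Face F)), ∃ σ : F →+* ℂ, a = lefChar g.corner (fun _ => ({σ} : Finset (F →+* ℂ)))} := by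
  obtain ⟨D, -, -, -⟩ := exists_datum_of_aut_involution σ₀ u₀ w₀ hord hcσ hw hww hdeg
  exact exists_faces_hgen_of_indexTwoCyclic D σ₀

end Summit.HodgeConjecture.CorCM.FaceIndexTwoCyclic
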